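import Literature.NumberTheory.Automorphic.ArchCongruenceTransport        -- ★ p06 (g9): `archFormOf_formCongr`, `map_embedding_formCongr_cm`, `coe_archCongr_apply` (the group half of (T-d))
import Literature.NumberTheory.Automorphic.UnitaryGroupArchTopology        -- ★ instances: `arch` is locally compact, second countable, Hausdorff
import Literature.NumberTheory.Automorphic.ArchTorusOrbitalFunction        -- ★ (V2′): brings ★ `quotientMeasure`, ★ `descConj`, ★ `isClosed_coe_centralizer_singleton`
import Literature.MeasureTheory.Group.InvariantQuotientTransport           -- ★ `cosetCongr`, `subgroupCongrHomeomorph`, `map_cosetCongr_quotientMeasure` (naturality of `dν ∕ dρ`)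
import Literature.MeasureTheory.Group.InvariantQuotientOrbitalTransport    -- ★ `forall_apply_mem_centralizer_singleton_iff_of_eq`
import Literature.NumberTheory.Automorphic.OrbitalIntegralCentralTransport  -- ★ `integral_descConj_quotientMeasure_eq_of_mulEquiv` (Bochner transport of orbital integrands along `e : G ≃* G′`, target point free)
import Mathlib.MeasureTheory.Integral.Bochner.Basic
import HarnessLib

/-!
# The archimedean congruence transport, ORBITAL half: torus∕orbital∕singular-orbital integrals on `U(H)(L ⊗ ℝ)` and on `U(c(P)ᵀ H P)(L ⊗ ℝ)`
# correspond under `g ↦ (P ⊗ 1) g (P ⊗ 1)⁻¹`; the per-place factors of that isomorphism; and the explicit rational congruence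
# `Φ₃ = c(Q)ᵀ · diag(½, 1, −½) · Q` putting the quasi-split form of `U(2,1)` in diagonal shape (ROAD-Sd (T-d), FILE 1 «group-and-measure half»)
(Rogawski 1990 §1.7 p. 6 «compatible measures», §14.4 p. 237 «`f_v = f′_v ∘ ψ_v⁻¹`»; Platonov–Rapinchuk 1994 §2.3; Deitmar–Echterhoff 2014 Thm. 1.5.3)

Topic `NumberTheory/Automorphic`; namespaces `Literature.MeasureTheory.Group` (§1, generic) and `Literature.NumberTheory.Automorphic.UnitaryGroup` (§2–§4).
THEOREMS ONLY (no `def`, no instance, no notation, no axiom, no named fact, no `sorry`).  Cell `pub/hodgecm-mathlib`, ENGINE T1 (crux H413 =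
`stmt-HodgeConjecture-24833`); floor-1 preparation, count-neutral, under books rows #88 (ST-∞) ∕ #111 (S-d): ROAD-Sd item (T-d) «CONGRUENCE TRANSPORT» for the
(L-use)∕(L-st) junction (LEAD DESK WORD T8-39, F0P3a-plan (g9), 2026-09-01; census `CENSUS-Td-CongruenceTransport.F0P3a-p02g10.md` 9b2b941dccae668a; memo of record
F0P3a-p06 (g9) `ROAD-Sd-3prime-congruence` items (a)–(e)); author F0P3a-p02 (g10).

WHY.  The archimedean limit-formula letters ★ `Rogawski1990/ArchLimitFormula` ((C-bdry), (J-nc)), the junction ★ J1 `ArchStableTorusOrbitalWallDeriv` and the whole torus stack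
(★ `archDiagTorus`, `circleDiagonal`, (V2)–(V9)) live on the unitary groups of DIAGONAL hermitian forms `diag β`, per place on `archLocal L 3 (diagonal β) w`.  The closer's
archimedean statements ((ST-∞) inside `SingularEllipticTransferCanonical`, `stub_Sc`, `stub_Sd`, and ★ `IsArchInnerTransfer` (14.2.1)) are typed on `U(H′)(L ⊗ ℝ)` for an
ARBITRARY hermitian anisotropic `H′` and on the quasi-split `U(Φ₃)(L ⊗ ℝ)`, `Φ₃` = the antidiagonal unit form.  Every hermitian `H′` is congruent over `L` to a diagonal form
(Landherr), and `Φ₃` is congruent to `diag(½, 1, −½)` by the explicit RATIONAL matrix `Q = [[1,0,1],[0,1,0],[1,0,−1]]` (§4); a congruence `H₂ = c(P)ᵀ H P` induces the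
isomorphism of topological groups `Φ_P : U(H₂)(L ⊗ ℝ) ≃ₜ* U(H)(L ⊗ ℝ)`, `g ↦ (P ⊗ 1) g (P ⊗ 1)⁻¹` (★ p06 `ArchCongruenceTransport`: the generic ★ `unitaryGroupOfFormCongrOfEq`
at ★ `archFormOf_formCongr`).  This file supplies what the junction reads ALONG such an isomorphism: (i) torus∕orbital integrals `∫ Θ(g γ g⁻¹) dν` and singular orbital integrals
`∫_{G∕Z} Θ(y γ y⁻¹) d(ν∕ρ)` (★ `descConj`, ★ `quotientMeasure`) correspond — print's «compatible measures» [Rogawski1990 §1.7 p. 6] and «`f_v = f′_v ∘ ψ_v⁻¹`» [§14.4 p. 237];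
(ii) `Φ_P` is the product of its per-place factors `g_w ↦ σ_w(P) g_w σ_w(P)⁻¹` under ★ `archPiEquivCM` (the letters are PER PLACE, desk ruling (V7)); (iii) the quasi-split datum.
Everything is stated for an ABSTRACT isomorphism `Φ` acting by `g ↦ T g T⁻¹` (hypothesis `hΦ`), as in ★ A-p19 `map_archTopFormHaar_of_conj`; the tree's term satisfies `hΦ` by `rfl`
(`coe_archCongrOfEq_apply`).  The orbital-measure FAMILY transport (★ `OrbitalMeasureFamily.transport`, `classOrbitalIntegral_transport`, `IsQuotientOf.transport`,
`IsCanonical.transport`) is generic and ★ already (`Rogawski1990/LocalTransferTransport`, `IsQuotientOfTransport`, `LocalTransferTransportCanonical`) — read at `ψ := Φ_P`, not restated.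

WHAT IS PROVED.
* §1 GENERIC (`e : G ≃ₜ* G′`): `integral_comp_conj_map_continuousMulEquiv` (`∫_{G′} f(x·eγ·x⁻¹) d(e_*ν) = ∫_G f(e(gγg⁻¹)) dν`).  The singular∕quotient-measure twin
  `∫_{G′∕H′} F(y γ′ y⁻¹) d(e_*ν ∕ (e|_H)_*ρ) = ∫_{G∕H} F(e(xγx⁻¹)) d(ν∕ρ)` is ★ `Automorphic.integral_descConj_quotientMeasure_eq_of_mulEquiv` (`OrbitalIntegralCentralTransport` §2) — imported, not restated.
* §2 ARCH, along `Φ : U(H₂)(L ⊗ ℝ) ≃ₜ* U(H)(L ⊗ ℝ)` with `hΦ : ↑(Φ g) = T·↑g·T⁻¹`: `formCongr_map_mixedEmbedding_archFormOf_eq` + `coe_archCongrOfEq_apply` (the tree's term for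
  `h : formCongr c P H = H₂` and its action, `rfl`); `apply_coe_archCongr` (ambient reading `Θ ↑↑(Φx) = Θ(T·↑↑x·T⁻¹)`), `hasCompactSupport_comp_archCongr`,
  **`integral_comp_conj_archCongr`** (torus∕orbital integrals of an ambient `Θ`), **`integral_descConj_quotientMeasure_archCongr`** (singular orbital integrals = ★ `integral_descConj_quotientMeasure_eq_of_mulEquiv` READ ON `arch`: the shape of the RHS of ★
  `ArchLimitFormulaNoncompactWall`; `…_restrictSubgroup` = the same with the centraliser measure pushed along the `ContinuousMulEquiv.restrictSubgroup` TERM, p07's token note).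
* §3 PER PLACE: `map_embedding_formCongr_eq_formCongr` (`σ_w(c(P)ᵀHP) = formCongr conj (σ_wP) (σ_wH)`), `mem_archLocal_iff_conjEquiv_mem_of_formCongr_eq` (so the per-place iso is the TERM
  `ContinuousMulEquiv.restrictSubgroup (GLn.conjEquiv (σ_w P)) (archLocal L N H₂ w) (archLocal L N H w) _`, ★ p07 pattern), `coe_archLocalCongr_apply` (`rfl`), `map_evalC_map_mixedEmbedding`
  (`(P ⊗ 1)_w = σ_w P`), **`archPiEquivCM_archCongr`** (`(Φ g)_w = Φ_w (g_w)` for any per-place `Φ_w` acting by `T_w = T_w`-conjugation with `(T)_w = T_w`).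
* §4 THE QUASI-SPLIT DATUM (`N = 3`): `det_quasiSplitFrame` (`= −2`), **`formCongr_quasiSplitFrame_diagonal`** (`c(Q)ᵀ·diag(½,1,−½)·Q = Φ₃`), and the weight facts for
  `β = (½, 1, −½)`: non-zero, `c`-fixed (`diagonal β` is `c`-hermitian), real at every embedding with signs `(+, +, −)` — every complex place is a `(2,1)` place and the
  `{0,2}`-wall is NONCOMPACT (`re σ_w β₀ · re σ_w β₂ < 0`), the `{0,1}`-wall COMPACT.
NOT HERE (FILE 2 `Rogawski1990/ArchInnerTransferCongruence`): stable conjugacy ∕ `archStableOrbitalIntegral` ∕ `IsArchInnerTransfer` ∕ Kottwitz signs ∕ `ArchSmooth` under `Φ`.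
HONEST LABEL: HC_CM is proved only modulo the printed citations until rung 0 closes; this file is bookkeeping and pays nothing by itself.

## References
* [Rogawski1990] J. D. Rogawski, *Automorphic Representations of Unitary Groups in Three Variables*, Ann. of Math. Stud. 123 (1990), §1.7 p. 6 («compatible measures» under an
  isomorphism of inner forms), §14.4 p. 237 («we use `ψ_v` to identify `G′_v` with `G_v` … `f_v = f′_v ∘ ψ_v⁻¹`»), §14.1 p. 232 (the forms `Φ`, `H′`).
* [PlatonovRapinchuk1994] V. Platonov, A. Rapinchuk, *Algebraic Groups and Number Theory* (1994), §2.3 (equivalent hermitian forms have conjugate unitary groups).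
* [DeitmarEchterhoff2014] A. Deitmar, S. Echterhoff, *Principles of Harmonic Analysis*, 2nd ed. (2014), Thm. 1.5.3 (the invariant quotient measure; naturality).
* [Folland1995] G. B. Folland, *A Course in Abstract Harmonic Analysis* (1995), (2.52) (transport of Haar integrals along isomorphisms).
-/

set_option autoImplicit false

noncomputable section

open MeasureTheory Measure Filter Topology NumberField NumberField.InfinitePlace NumberField.mixedEmbedding
open scoped Matrix MatrixGroups

/-! ## §1 Generic: conjugation integrands and singular orbital integrals along an isomorphism of topological groups -/

namespace Literature.MeasureTheory.Group

section ConjIntegrand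

variable {G G' : Type*} [Group G] [Group G'] [TopologicalSpace G] [TopologicalSpace G']
  [MeasurableSpace G] [BorelSpace G] [MeasurableSpace G'] [BorelSpace G']

/-- **Change of variables for conjugation integrands**: `∫_{G′} f(x · eγ · x⁻¹) d(e_*ν)(x) = ∫_G f(e(g · γ · g⁻¹)) dν(g)` along an isomorphism of topological groups
`e : G ≃ₜ* G′` (Mathlib `integral_map_equiv` for the homeomorphism, then multiplicativity). [cite: Folland1995, (2.52)] -/
theorem integral_comp_conj_map_continuousMulEquiv {E : Type*} [NormedAddCommGroup E] [NormedSpace ℝ E]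
    (e : G ≃ₜ* G') (ν : Measure G) (f : G' → E) (γ : G) :
    ∫ x, f (x * e γ * x⁻¹) ∂(ν.map e) = ∫ g, f (e (g * γ * g⁻¹)) ∂ν := by
  have hmap : ν.map e = ν.map e.toHomeomorph.toMeasurableEquiv := rfl
  rw [hmap, integral_map_equiv]
  refine integral_congr_ae (Eventually.of_forall fun g => ?_)
  show f (e g * e γ * (e g)⁻¹) = f (e (g * γ * g⁻¹))
  rw [map_mul, map_mul, map_inv]

end ConjIntegrand


end Literature.MeasureTheory.Group

/-! ## §2 The archimedean congruence isomorphism on integrals -/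

namespace Literature.NumberTheory.Automorphic

namespace UnitaryGroup

open Literature.MeasureTheory.Group

section ArchCongr

variable (L : Type) [Field L] [NumberField L] [IsCMField L] {N : ℕ}

/-- **THE CONGRUENCE ON THE ARCHIMEDEAN FORMS, `OfEq` SHAPE**: `h : c(P)ᵀ H P = H₂` over `L` gives `(c⊗1)(P⊗1)ᵀ · (H ⊗ 1) · (P ⊗ 1) = H₂ ⊗ 1` (★ `archFormOf_formCongr`), i.e. exactly
the hypothesis of ★ `unitaryGroupOfFormCongrOfEq` producing `Φ_P : U(H₂)(L ⊗ ℝ) ≃ₜ* U(H)(L ⊗ ℝ)` with the target form spelled `H₂` (e.g. the LITERAL antidiagonal `Φ₃` of ★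
`IsArchInnerTransfer`). [cite: PlatonovRapinchuk1994, §2.3] [cite: Rogawski1990, §14.1 p. 232] -/
theorem formCongr_map_mixedEmbedding_archFormOf_eq {P : GL (Fin N) L} {H H₂ : Matrix (Fin N) (Fin N) L} (h : formCongr (cmConjRingHom L) P H = H₂) :
    formCongr (conjMixed (↥(maximalRealSubfield L)) L (IsCMField.complexConj L)) (Matrix.GeneralLinearGroup.map (mixedEmbedding L) P) (archFormOf L N H) =
      archFormOf L N H₂ := by
  rw [← h, archFormOf_formCongr]

/-- The congruence isomorphism `Φ_P` (the TERM ★ `unitaryGroupOfFormCongrOfEq … (formCongr_map_mixedEmbedding_archFormOf_eq L h)`) acts by `g ↦ (P ⊗ 1) g (P ⊗ 1)⁻¹` (definitional) —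
the hypothesis `hΦ` of every lemma below is discharged by `fun _ => rfl` for it. [cite: PlatonovRapinchuk1994, §2.3] -/
theorem coe_archCongrOfEq_apply {P : GL (Fin N) L} {H H₂ : Matrix (Fin N) (Fin N) L} (h : formCongr (cmConjRingHom L) P H = H₂)
    (g : arch (↥(maximalRealSubfield L)) L (IsCMField.complexConj L) N H₂) :
    ((unitaryGroupOfFormCongrOfEq (conjMixed (↥(maximalRealSubfield L)) L (IsCMField.complexConj L)) (Matrix.GeneralLinearGroup.map (mixedEmbedding L) P)
          (archFormOf L N H) (archFormOf L N H₂) (formCongr_map_mixedEmbedding_archFormOf_eq L h) g :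
        arch (↥(maximalRealSubfield L)) L (IsCMField.complexConj L) N H) : GL (Fin N) (mixedSpace L)) =
      Matrix.GeneralLinearGroup.map (mixedEmbedding L) P * (g : GL (Fin N) (mixedSpace L)) * (Matrix.GeneralLinearGroup.map (mixedEmbedding L) P)⁻¹ :=
  rfl

variable {H H₂ : Matrix (Fin N) (Fin N) L} (T : GL (Fin N) (mixedSpace L))
  (Φ : arch (↥(maximalRealSubfield L)) L (IsCMField.complexConj L) N H₂ ≃ₜ* arch (↥(maximalRealSubfield L)) L (IsCMField.complexConj L) N H)
  (hΦ : ∀ g : arch (↥(maximalRealSubfield L)) L (IsCMField.complexConj L) N H₂,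
    ((Φ g : arch (↥(maximalRealSubfield L)) L (IsCMField.complexConj L) N H) : GL (Fin N) (mixedSpace L)) = T * (g : GL (Fin N) (mixedSpace L)) * T⁻¹)

include hΦ in
/-- **AMBIENT READING**: for an ambient function `Θ` on `M_N(L ⊗ ℝ)`, `Θ ↑↑(Φ x) = Θ (T · ↑↑x · T⁻¹)`. [cite: PlatonovRapinchuk1994, §2.3] -/
theorem apply_coe_archCongr {E : Type*} (Θ : Matrix (Fin N) (Fin N) (mixedSpace L) → E) (x : arch (↥(maximalRealSubfield L)) L (IsCMField.complexConj L) N H₂) :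
    Θ (((Φ x : arch (↥(maximalRealSubfield L)) L (IsCMField.complexConj L) N H) : GL (Fin N) (mixedSpace L)) : Matrix (Fin N) (Fin N) (mixedSpace L)) =
      Θ ((T : Matrix (Fin N) (Fin N) (mixedSpace L)) * ((x : GL (Fin N) (mixedSpace L)) : Matrix (Fin N) (Fin N) (mixedSpace L)) *
        ((T⁻¹ : GL (Fin N) (mixedSpace L)) : Matrix (Fin N) (Fin N) (mixedSpace L))) := by
  rw [hΦ x, Units.val_mul, Units.val_mul]

include hΦ in
/-- **COMPACT SUPPORT ON THE GROUP IS KEPT**: if `k ↦ Θ ↑↑k` has compact support on `U(H)(L ⊗ ℝ)`, then `k′ ↦ Θ (T ↑↑k′ T⁻¹)` has compact support on `U(H₂)(L ⊗ ℝ)` (pull-back along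
the homeomorphism `Φ`). [cite: Folland1995, (2.52)] [cite: PlatonovRapinchuk1994, §2.3] -/
theorem hasCompactSupport_comp_archCongr {E : Type*} [Zero E] [TopologicalSpace E] (Θ : Matrix (Fin N) (Fin N) (mixedSpace L) → E)
    (hΘc : HasCompactSupport fun k : arch (↥(maximalRealSubfield L)) L (IsCMField.complexConj L) N H =>
      Θ (((k : GL (Fin N) (mixedSpace L)) : Matrix (Fin N) (Fin N) (mixedSpace L)))) :
    HasCompactSupport fun k : arch (↥(maximalRealSubfield L)) L (IsCMField.complexConj L) N H₂ =>
      Θ ((T : Matrix (Fin N) (Fin N) (mixedSpace L)) * ((k : GL (Fin N) (mixedSpace L)) : Matrix (Fin N) (Fin N) (mixedSpace L)) *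
        ((T⁻¹ : GL (Fin N) (mixedSpace L)) : Matrix (Fin N) (Fin N) (mixedSpace L))) := by
  have heq : (fun k : arch (↥(maximalRealSubfield L)) L (IsCMField.complexConj L) N H₂ =>
      Θ ((T : Matrix (Fin N) (Fin N) (mixedSpace L)) * ((k : GL (Fin N) (mixedSpace L)) : Matrix (Fin N) (Fin N) (mixedSpace L)) *
        ((T⁻¹ : GL (Fin N) (mixedSpace L)) : Matrix (Fin N) (Fin N) (mixedSpace L)))) =
      (fun k : arch (↥(maximalRealSubfield L)) L (IsCMField.complexConj L) N H =>
        Θ (((k : GL (Fin N) (mixedSpace L)) : Matrix (Fin N) (Fin N) (mixedSpace L)))) ∘ Φ.toHomeomorph := by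
    funext k
    exact (apply_coe_archCongr L T Φ hΦ Θ k).symm
  rw [heq]
  exact hΘc.comp_homeomorph Φ.toHomeomorph

include hΦ in
/-- **TORUS ∕ ORBITAL INTEGRALS CORRESPOND**: for an ambient `Θ`, a measure `ν` on `U(H₂)(L ⊗ ℝ)` and `γ ∈ U(H₂)(L ⊗ ℝ)`,
`∫_{U(H)} Θ ↑↑(x · Φγ · x⁻¹) d(Φ_*ν)(x) = ∫_{U(H₂)} Θ (T · ↑↑(g γ g⁻¹) · T⁻¹) dν(g)` — print's «`f_v = f′_v ∘ ψ_v⁻¹`» for orbital integrals; with `ν` Haar, `Φ_*ν` is Haar (Mathlib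
`ContinuousMulEquiv.isHaarMeasure_map`). [cite: Rogawski1990, §14.4 p. 237] [cite: Folland1995, (2.52)] -/
theorem integral_comp_conj_archCongr {E : Type*} [NormedAddCommGroup E] [NormedSpace ℝ E]
    [MeasurableSpace (arch (↥(maximalRealSubfield L)) L (IsCMField.complexConj L) N H₂)] [BorelSpace (arch (↥(maximalRealSubfield L)) L (IsCMField.complexConj L) N H₂)]
    [MeasurableSpace (arch (↥(maximalRealSubfield L)) L (IsCMField.complexConj L) N H)] [BorelSpace (arch (↥(maximalRealSubfield L)) L (IsCMField.complexConj L) N H)]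
    (ν : Measure (arch (↥(maximalRealSubfield L)) L (IsCMField.complexConj L) N H₂)) (Θ : Matrix (Fin N) (Fin N) (mixedSpace L) → E)
    (γ : arch (↥(maximalRealSubfield L)) L (IsCMField.complexConj L) N H₂) :
    ∫ x, Θ ((((x * Φ γ * x⁻¹ : arch (↥(maximalRealSubfield L)) L (IsCMField.complexConj L) N H)) : GL (Fin N) (mixedSpace L)) : Matrix (Fin N) (Fin N) (mixedSpace L)) ∂(ν.map Φ) =
      ∫ g, Θ ((T : Matrix (Fin N) (Fin N) (mixedSpace L)) * (((g * γ * g⁻¹ : arch (↥(maximalRealSubfield L)) L (IsCMField.complexConj L) N H₂) : GL (Fin N) (mixedSpace L)) :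
          Matrix (Fin N) (Fin N) (mixedSpace L)) * ((T⁻¹ : GL (Fin N) (mixedSpace L)) : Matrix (Fin N) (Fin N) (mixedSpace L))) ∂ν := by
  rw [integral_comp_conj_map_continuousMulEquiv Φ ν (fun x : arch (↥(maximalRealSubfield L)) L (IsCMField.complexConj L) N H =>
    Θ (((x : GL (Fin N) (mixedSpace L)) : Matrix (Fin N) (Fin N) (mixedSpace L)))) γ]
  refine integral_congr_ae (Eventually.of_forall fun g => ?_)
  exact apply_coe_archCongr L T Φ hΦ Θ _

/-- `Φ` carries the centraliser of `γ` onto the centraliser of `γ′ = Φ γ` (★ `forall_apply_mem_centralizer_singleton_iff_of_eq`). [cite: PlatonovRapinchuk1994, §2.3] -/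
theorem forall_archCongr_mem_centralizer_iff {γ : arch (↥(maximalRealSubfield L)) L (IsCMField.complexConj L) N H₂}
    {γ' : arch (↥(maximalRealSubfield L)) L (IsCMField.complexConj L) N H} (hγ' : Φ γ = γ') :
    ∀ g, Φ.toMulEquiv g ∈ Subgroup.centralizer ({γ'} : Set (arch (↥(maximalRealSubfield L)) L (IsCMField.complexConj L) N H)) ↔
      g ∈ Subgroup.centralizer ({γ} : Set (arch (↥(maximalRealSubfield L)) L (IsCMField.complexConj L) N H₂)) :=
  forall_apply_mem_centralizer_singleton_iff_of_eq Φ.toMulEquiv hγ'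

/-- **SINGULAR ORBITAL INTEGRALS CORRESPOND** (the RHS currency of ★ `ArchLimitFormulaNoncompactWall`, read on `arch`): for `γ ∈ U(H₂)(L ⊗ ℝ)`, `γ′ = Φ γ`, a two-sided Haar measure
`ν` on `U(H₂)(L ⊗ ℝ)`, an inversion-invariant Haar measure `ρ` on `Z(γ)` and `ρ′ = (Φ|_{Z(γ)})_*ρ` on `Z(γ′)`:
`∫_{U(H)∕Z(γ′)} F(y γ′ y⁻¹) d(Φ_*ν ∕ ρ′) = ∫_{U(H₂)∕Z(γ)} F(Φ(x γ x⁻¹)) d(ν ∕ ρ)` for every `F` (★ `Automorphic.integral_descConj_quotientMeasure_eq_of_mulEquiv` at `e := Φ`; the closed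
centralisers are locally compact, so the Haar measures on them are σ-finite). [cite: DeitmarEchterhoff2014, Thm. 1.5.3] [cite: Rogawski1990, §1.7 p. 6] -/
theorem integral_descConj_quotientMeasure_archCongr
    [MeasurableSpace (arch (↥(maximalRealSubfield L)) L (IsCMField.complexConj L) N H₂)] [BorelSpace (arch (↥(maximalRealSubfield L)) L (IsCMField.complexConj L) N H₂)]
    [MeasurableSpace (arch (↥(maximalRealSubfield L)) L (IsCMField.complexConj L) N H)] [BorelSpace (arch (↥(maximalRealSubfield L)) L (IsCMField.complexConj L) N H)]
    {γ : arch (↥(maximalRealSubfield L)) L (IsCMField.complexConj L) N H₂} {γ' : arch (↥(maximalRealSubfield L)) L (IsCMField.complexConj L) N H} (hγ' : Φ γ = γ')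
    [MeasurableSpace (arch (↥(maximalRealSubfield L)) L (IsCMField.complexConj L) N H₂ ⧸ Subgroup.centralizer ({γ} : Set (arch (↥(maximalRealSubfield L)) L (IsCMField.complexConj L) N H₂)))]
    [BorelSpace (arch (↥(maximalRealSubfield L)) L (IsCMField.complexConj L) N H₂ ⧸ Subgroup.centralizer ({γ} : Set (arch (↥(maximalRealSubfield L)) L (IsCMField.complexConj L) N H₂)))]
    [MeasurableSpace (arch (↥(maximalRealSubfield L)) L (IsCMField.complexConj L) N H ⧸ Subgroup.centralizer ({γ'} : Set (arch (↥(maximalRealSubfield L)) L (IsCMField.complexConj L) N H)))]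
    [BorelSpace (arch (↥(maximalRealSubfield L)) L (IsCMField.complexConj L) N H ⧸ Subgroup.centralizer ({γ'} : Set (arch (↥(maximalRealSubfield L)) L (IsCMField.complexConj L) N H)))]
    (ρ : Measure (Subgroup.centralizer ({γ} : Set (arch (↥(maximalRealSubfield L)) L (IsCMField.complexConj L) N H₂))))
    [ρ.IsHaarMeasure] [ρ.IsInvInvariant]
    (ρ' : Measure (Subgroup.centralizer ({γ'} : Set (arch (↥(maximalRealSubfield L)) L (IsCMField.complexConj L) N H))))
    [ρ'.IsHaarMeasure] [ρ'.IsInvInvariant]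
    (hρ' : ρ' = Measure.map (subgroupCongrHomeomorph Φ.toMulEquiv _ _ (forall_archCongr_mem_centralizer_iff L Φ hγ') Φ.continuous Φ.symm.continuous) ρ)
    (ν : Measure (arch (↥(maximalRealSubfield L)) L (IsCMField.complexConj L) N H₂)) [ν.IsHaarMeasure] [ν.IsMulRightInvariant]
    [(ν.map Φ).IsMulRightInvariant]
    (hZγ : ∀ g ∈ Subgroup.centralizer ({γ} : Set (arch (↥(maximalRealSubfield L)) L (IsCMField.complexConj L) N H₂)), g * γ = γ * g)
    (hZγ' : ∀ g ∈ Subgroup.centralizer ({γ'} : Set (arch (↥(maximalRealSubfield L)) L (IsCMField.complexConj L) N H)), g * γ' = γ' * g)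
    {E : Type*} [NormedAddCommGroup E] [NormedSpace ℝ E] (F : arch (↥(maximalRealSubfield L)) L (IsCMField.complexConj L) N H → E) :
    ∫ y, descConj γ' (Subgroup.centralizer ({γ'} : Set (arch (↥(maximalRealSubfield L)) L (IsCMField.complexConj L) N H))) hZγ' F y
        ∂quotientMeasure _ ρ' (isClosed_coe_centralizer_singleton γ') (ν.map Φ) =
      ∫ x, descConj γ (Subgroup.centralizer ({γ} : Set (arch (↥(maximalRealSubfield L)) L (IsCMField.complexConj L) N H₂))) hZγ (F ∘ Φ) x
        ∂quotientMeasure _ ρ (isClosed_coe_centralizer_singleton γ) ν := by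
  haveI : LocallyCompactSpace (Subgroup.centralizer ({γ} : Set (arch (↥(maximalRealSubfield L)) L (IsCMField.complexConj L) N H₂))) :=
    (isClosed_coe_centralizer_singleton γ).locallyCompactSpace
  haveI : LocallyCompactSpace (Subgroup.centralizer ({γ'} : Set (arch (↥(maximalRealSubfield L)) L (IsCMField.complexConj L) N H))) :=
    (isClosed_coe_centralizer_singleton γ').locallyCompactSpace
  exact Literature.NumberTheory.Automorphic.integral_descConj_quotientMeasure_eq_of_mulEquiv Φ.toMulEquiv Φ.continuous Φ.symm.continuous _ _
    (hH := isClosed_coe_centralizer_singleton γ) (hH' := isClosed_coe_centralizer_singleton γ')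
    (forall_archCongr_mem_centralizer_iff L Φ hγ') ρ ρ' ν (ν.map Φ) hρ' rfl hγ' hZγ hZγ' F

/-- The SAME, with the centraliser measure pushed along the RESTRICTED ISO AS A `ContinuousMulEquiv` TERM `Φ|_Z := ContinuousMulEquiv.restrictSubgroup Φ Z(γ) Z(γ′) _` (so that
`IsHaarMeasure (ρ.map Φ|_Z)` is Mathlib's instance `ContinuousMulEquiv.isHaarMeasure_map`, ★ p07 `ArchLocalRelabelTransport` pattern; same underlying map as ★ `subgroupCongrHomeomorph`).
[cite: DeitmarEchterhoff2014, Thm. 1.5.3] [cite: Rogawski1990, §1.7 p. 6] -/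
theorem integral_descConj_quotientMeasure_archCongr_restrictSubgroup
    [MeasurableSpace (arch (↥(maximalRealSubfield L)) L (IsCMField.complexConj L) N H₂)] [BorelSpace (arch (↥(maximalRealSubfield L)) L (IsCMField.complexConj L) N H₂)]
    [MeasurableSpace (arch (↥(maximalRealSubfield L)) L (IsCMField.complexConj L) N H)] [BorelSpace (arch (↥(maximalRealSubfield L)) L (IsCMField.complexConj L) N H)]
    {γ : arch (↥(maximalRealSubfield L)) L (IsCMField.complexConj L) N H₂} {γ' : arch (↥(maximalRealSubfield L)) L (IsCMField.complexConj L) N H} (hγ' : Φ γ = γ')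
    [MeasurableSpace (arch (↥(maximalRealSubfield L)) L (IsCMField.complexConj L) N H₂ ⧸ Subgroup.centralizer ({γ} : Set (arch (↥(maximalRealSubfield L)) L (IsCMField.complexConj L) N H₂)))]
    [BorelSpace (arch (↥(maximalRealSubfield L)) L (IsCMField.complexConj L) N H₂ ⧸ Subgroup.centralizer ({γ} : Set (arch (↥(maximalRealSubfield L)) L (IsCMField.complexConj L) N H₂)))]
    [MeasurableSpace (arch (↥(maximalRealSubfield L)) L (IsCMField.complexConj L) N H ⧸ Subgroup.centralizer ({γ'} : Set (arch (↥(maximalRealSubfield L)) L (IsCMField.complexConj L) N H)))]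
    [BorelSpace (arch (↥(maximalRealSubfield L)) L (IsCMField.complexConj L) N H ⧸ Subgroup.centralizer ({γ'} : Set (arch (↥(maximalRealSubfield L)) L (IsCMField.complexConj L) N H)))]
    (ρ : Measure (Subgroup.centralizer ({γ} : Set (arch (↥(maximalRealSubfield L)) L (IsCMField.complexConj L) N H₂))))
    [ρ.IsHaarMeasure] [ρ.IsInvInvariant]
    (ρ' : Measure (Subgroup.centralizer ({γ'} : Set (arch (↥(maximalRealSubfield L)) L (IsCMField.complexConj L) N H))))
    [ρ'.IsHaarMeasure] [ρ'.IsInvInvariant]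
    (hρ' : ρ' = ρ.map (ContinuousMulEquiv.restrictSubgroup Φ
      (Subgroup.centralizer ({γ} : Set (arch (↥(maximalRealSubfield L)) L (IsCMField.complexConj L) N H₂)))
      (Subgroup.centralizer ({γ'} : Set (arch (↥(maximalRealSubfield L)) L (IsCMField.complexConj L) N H)))
      fun g => (forall_archCongr_mem_centralizer_iff L Φ hγ' g).symm))
    (ν : Measure (arch (↥(maximalRealSubfield L)) L (IsCMField.complexConj L) N H₂)) [ν.IsHaarMeasure] [ν.IsMulRightInvariant]
    [(ν.map Φ).IsMulRightInvariant]
    (hZγ : ∀ g ∈ Subgroup.centralizer ({γ} : Set (arch (↥(maximalRealSubfield L)) L (IsCMField.complexConj L) N H₂)), g * γ = γ * g)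
    (hZγ' : ∀ g ∈ Subgroup.centralizer ({γ'} : Set (arch (↥(maximalRealSubfield L)) L (IsCMField.complexConj L) N H)), g * γ' = γ' * g)
    {E : Type*} [NormedAddCommGroup E] [NormedSpace ℝ E] (F : arch (↥(maximalRealSubfield L)) L (IsCMField.complexConj L) N H → E) :
    ∫ y, descConj γ' (Subgroup.centralizer ({γ'} : Set (arch (↥(maximalRealSubfield L)) L (IsCMField.complexConj L) N H))) hZγ' F y
        ∂quotientMeasure _ ρ' (isClosed_coe_centralizer_singleton γ') (ν.map Φ) =
      ∫ x, descConj γ (Subgroup.centralizer ({γ} : Set (arch (↥(maximalRealSubfield L)) L (IsCMField.complexConj L) N H₂))) hZγ (F ∘ Φ) x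
        ∂quotientMeasure _ ρ (isClosed_coe_centralizer_singleton γ) ν := by
  have hfun : (⇑(ContinuousMulEquiv.restrictSubgroup Φ
      (Subgroup.centralizer ({γ} : Set (arch (↥(maximalRealSubfield L)) L (IsCMField.complexConj L) N H₂)))
      (Subgroup.centralizer ({γ'} : Set (arch (↥(maximalRealSubfield L)) L (IsCMField.complexConj L) N H)))
      fun g => (forall_archCongr_mem_centralizer_iff L Φ hγ' g).symm) :
        Subgroup.centralizer ({γ} : Set (arch (↥(maximalRealSubfield L)) L (IsCMField.complexConj L) N H₂)) →
          Subgroup.centralizer ({γ'} : Set (arch (↥(maximalRealSubfield L)) L (IsCMField.complexConj L) N H))) =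
      ⇑(subgroupCongrHomeomorph Φ.toMulEquiv _ _ (forall_archCongr_mem_centralizer_iff L Φ hγ') Φ.continuous Φ.symm.continuous) := by
    funext g
    exact Subtype.ext rfl
  rw [hfun] at hρ'
  exact integral_descConj_quotientMeasure_archCongr L Φ hγ' ρ ρ' hρ' ν hZγ hZγ' F

end ArchCongr

/-! ## §3 Per place: the factors `g_w ↦ σ_w(P) g_w σ_w(P)⁻¹` of `Φ_P` under `U(H)(L ⊗ ℝ) ≃ₜ* Π_w U(σ_w H)(ℂ)` -/

section PerPlace

variable (L : Type) [Field L] [NumberField L] [IsCMField L] {N : ℕ}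

/-- At a complex embedding `σ_w`: `σ_w(c(P)ᵀ H P) = formCongr conj (σ_w P) (σ_w H)` (★ `map_embedding_formCongr_cm`: `σ_w ∘ c = conj ∘ σ_w` on a CM field).
[cite: Rogawski1990, §14.1 p. 232] [cite: PlatonovRapinchuk1994, §2.3] -/
theorem map_embedding_formCongr_eq_formCongr (P : GL (Fin N) L) (H : Matrix (Fin N) (Fin N) L) (w : {w : InfinitePlace L // IsComplex w}) :
    (formCongr (cmConjRingHom L) P H).map w.1.embedding =
      formCongr (starRingEnd ℂ) (Matrix.GeneralLinearGroup.map (w.1.embedding : L →+* ℂ) P) (H.map w.1.embedding) := by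
  rw [map_embedding_formCongr_cm, formCongr, Matrix.conjTranspose, Matrix.transpose_map]
  rfl

/-- **`g ∈ U(σ_w H₂)(ℂ) ↔ σ_w(P) g σ_w(P)⁻¹ ∈ U(σ_w H)(ℂ)`** for `h : c(P)ᵀ H P = H₂` — the hypothesis of ★ `ContinuousMulEquiv.restrictSubgroup` making `GLn.conjEquiv (σ_w P)` restrict to
the PER-PLACE congruence isomorphism `Φ_{P,w} : archLocal L N H₂ w ≃ₜ* archLocal L N H w` (★ p07 `ArchLocalRelabelTransport` pattern; no new definition).
[cite: PlatonovRapinchuk1994, §2.3] -/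
theorem mem_archLocal_iff_conjEquiv_mem_of_formCongr_eq {P : GL (Fin N) L} {H H₂ : Matrix (Fin N) (Fin N) L} (h : formCongr (cmConjRingHom L) P H = H₂)
    (w : {w : InfinitePlace L // IsComplex w}) (g : GL (Fin N) ℂ) :
    g ∈ archLocal L N H₂ w ↔ GLn.conjEquiv (Matrix.GeneralLinearGroup.map (w.1.embedding : L →+* ℂ) P) g ∈ archLocal L N H w := by
  rw [GLn.conjEquiv_apply]
  show g ∈ unitaryGroupOfForm (starRingEnd ℂ) (H₂.map w.1.embedding) ↔ _ ∈ unitaryGroupOfForm (starRingEnd ℂ) (H.map w.1.embedding)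
  rw [conj_mem_unitaryGroupOfForm_iff, ← h, map_embedding_formCongr_eq_formCongr]

/-- The per-place congruence isomorphism acts by `g ↦ σ_w(P) g σ_w(P)⁻¹` (definitional). [cite: PlatonovRapinchuk1994, §2.3] -/
theorem coe_archLocalCongr_apply {P : GL (Fin N) L} {H H₂ : Matrix (Fin N) (Fin N) L} (h : formCongr (cmConjRingHom L) P H = H₂)
    (w : {w : InfinitePlace L // IsComplex w}) (g : archLocal L N H₂ w) :
    ((ContinuousMulEquiv.restrictSubgroup (GLn.conjEquiv (Matrix.GeneralLinearGroup.map (w.1.embedding : L →+* ℂ) P)) (archLocal L N H₂ w) (archLocal L N H w)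
          (mem_archLocal_iff_conjEquiv_mem_of_formCongr_eq L h w) g : archLocal L N H w) : GL (Fin N) ℂ) =
      Matrix.GeneralLinearGroup.map (w.1.embedding : L →+* ℂ) P * (g : GL (Fin N) ℂ) * (Matrix.GeneralLinearGroup.map (w.1.embedding : L →+* ℂ) P)⁻¹ :=
  rfl

omit [NumberField L] [IsCMField L] in
/-- **`(P ⊗ 1)_w = σ_w(P)`**: the `w`-component of the rational matrix `P ⊗ 1 ∈ GL_N(L ⊗ ℝ)` (Mathlib `mixedEmbedding_apply_isComplex`). [cite: Rogawski1990, §14.1 p. 232] -/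
theorem map_evalC_map_mixedEmbedding (P : GL (Fin N) L) (w : {w : InfinitePlace L // IsComplex w}) :
    Matrix.GeneralLinearGroup.map (evalC L w) (Matrix.GeneralLinearGroup.map (mixedEmbedding L) P) =
      Matrix.GeneralLinearGroup.map (w.1.embedding : L →+* ℂ) P := by
  apply Units.ext
  ext i j
  exact mixedEmbedding_apply_isComplex L ((P : Matrix (Fin N) (Fin N) L) i j) w

/-- **THE CONGRUENCE ISO IS THE PRODUCT OF ITS PER-PLACE FACTORS**: if `Φ` acts on `U(H₂)(L ⊗ ℝ)` by `T`-conjugation and `Φ_w` acts on `U(σ_w H₂)(ℂ)` by `T_w`-conjugation with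
`T_w = (T)_w`, then `(Φ g)_w = Φ_w (g_w)` under ★ `archPiEquivCM` — so a PER-PLACE statement (desk ruling (V7): the letters are per place) transported along `Φ_w` is the
`w`-component of the global transport along `Φ`. [cite: BorelJacquet1979, §4.1] [cite: PlatonovRapinchuk1994, §2.3] -/
theorem archPiEquivCM_archCongr {H H₂ : Matrix (Fin N) (Fin N) L} (T : GL (Fin N) (mixedSpace L))
    (Φ : arch (↥(maximalRealSubfield L)) L (IsCMField.complexConj L) N H₂ ≃ₜ* arch (↥(maximalRealSubfield L)) L (IsCMField.complexConj L) N H)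
    (hΦ : ∀ g : arch (↥(maximalRealSubfield L)) L (IsCMField.complexConj L) N H₂,
      ((Φ g : arch (↥(maximalRealSubfield L)) L (IsCMField.complexConj L) N H) : GL (Fin N) (mixedSpace L)) = T * (g : GL (Fin N) (mixedSpace L)) * T⁻¹)
    (w : {w : InfinitePlace L // IsComplex w}) (Tw : GL (Fin N) ℂ) (Φw : archLocal L N H₂ w ≃ₜ* archLocal L N H w)
    (hΦw : ∀ g : archLocal L N H₂ w, ((Φw g : archLocal L N H w) : GL (Fin N) ℂ) = Tw * (g : GL (Fin N) ℂ) * Tw⁻¹)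
    (hT : Matrix.GeneralLinearGroup.map (evalC L w) T = Tw) (g : arch (↥(maximalRealSubfield L)) L (IsCMField.complexConj L) N H₂) :
    archPiEquivCM N L H (Φ g) w = Φw (archPiEquivCM N L H₂ g w) := by
  apply Subtype.ext
  rw [hΦw, archPiEquivCM, archPiEquivCM, archPiEquiv_apply, archPiEquiv_apply, coe_archAt, coe_archAt, hΦ, map_mul, map_mul, map_inv, hT]

/-- The tree's terms: `(Φ_P g)_w = Φ_{P,w} (g_w)` for `h : c(P)ᵀ H P = H₂`, `Φ_P = ★ unitaryGroupOfFormCongrOfEq …`, `Φ_{P,w} = restrictSubgroup (GLn.conjEquiv (σ_w P)) …`.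
[cite: BorelJacquet1979, §4.1] [cite: PlatonovRapinchuk1994, §2.3] -/
theorem archPiEquivCM_archCongrOfEq {P : GL (Fin N) L} {H H₂ : Matrix (Fin N) (Fin N) L} (h : formCongr (cmConjRingHom L) P H = H₂)
    (w : {w : InfinitePlace L // IsComplex w}) (g : arch (↥(maximalRealSubfield L)) L (IsCMField.complexConj L) N H₂) :
    archPiEquivCM N L H
        (unitaryGroupOfFormCongrOfEq (conjMixed (↥(maximalRealSubfield L)) L (IsCMField.complexConj L)) (Matrix.GeneralLinearGroup.map (mixedEmbedding L) P)
          (archFormOf L N H) (archFormOf L N H₂) (formCongr_map_mixedEmbedding_archFormOf_eq L h) g) w =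
      ContinuousMulEquiv.restrictSubgroup (GLn.conjEquiv (Matrix.GeneralLinearGroup.map (w.1.embedding : L →+* ℂ) P)) (archLocal L N H₂ w) (archLocal L N H w)
          (mem_archLocal_iff_conjEquiv_mem_of_formCongr_eq L h w) (archPiEquivCM N L H₂ g w) :=
  archPiEquivCM_archCongr L (Matrix.GeneralLinearGroup.map (mixedEmbedding L) P) _ (coe_archCongrOfEq_apply L h) w
    (Matrix.GeneralLinearGroup.map (w.1.embedding : L →+* ℂ) P) _ (coe_archLocalCongr_apply L h w) (map_evalC_map_mixedEmbedding L P w) g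

end PerPlace

/-! ## §4 The quasi-split datum: `Φ₃ = c(Q)ᵀ · diag(½, 1, −½) · Q` with `Q = [[1,0,1],[0,1,0],[1,0,−1]] ∈ GL₃(ℚ)` -/

section QuasiSplit

variable (L : Type) [Field L] [NumberField L] [IsCMField L]

omit [NumberField L] [IsCMField L] in
/-- `det [[1,0,1],[0,1,0],[1,0,−1]] = −2`. [cite: Rogawski1990, §14.1 p. 232] -/
theorem det_quasiSplitFrame : Matrix.det !![(1 : L), 0, 1; 0, 1, 0; 1, 0, -1] = -2 := by
  rw [Matrix.det_fin_three]
  simp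
  norm_num

omit [IsCMField L] in
/-- `det [[1,0,1],[0,1,0],[1,0,−1]] ≠ 0` (characteristic zero). [cite: Rogawski1990, §14.1 p. 232] -/
theorem det_quasiSplitFrame_ne_zero : Matrix.det !![(1 : L), 0, 1; 0, 1, 0; 1, 0, -1] ≠ 0 := by
  rw [det_quasiSplitFrame]
  norm_num

/-- **THE QUASI-SPLIT CONGRUENCE**: `c(Q)ᵀ · diag(½, 1, −½) · Q = Φ₃` (the antidiagonal unit form of ★ `IsArchInnerTransfer` ∕ `cmDatum`), `Q = [[1,0,1],[0,1,0],[1,0,−1]]` RATIONAL (so `c(Q) = Q`):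
`x̄₀x₂ + x̄₁x₁ + x̄₂x₀ = ½|x₀ + x₂|² + |x₁|² − ½|x₀ − x₂|²`.  Hence `U(Φ₃)(L ⊗ ℝ) ≃ₜ* U(diag(½,1,−½))(L ⊗ ℝ)` is the TERM ★ `unitaryGroupOfFormCongrOfEq …
(formCongr_map_mixedEmbedding_archFormOf_eq L (formCongr_quasiSplitFrame_diagonal L))`, and the torus stack on `diag β` applies to the quasi-split group.
[cite: Rogawski1990, §14.1 p. 232] [cite: PlatonovRapinchuk1994, §2.3] -/
theorem formCongr_quasiSplitFrame_diagonal :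
    formCongr (cmConjRingHom L) (Matrix.GeneralLinearGroup.mkOfDetNeZero !![(1 : L), 0, 1; 0, 1, 0; 1, 0, -1] (det_quasiSplitFrame_ne_zero L))
        (Matrix.diagonal ![(2 : L)⁻¹, 1, -(2 : L)⁻¹]) =
      Matrix.of fun i j : Fin 3 => if i.val + j.val + 1 = 3 then (1 : L) else 0 := by
  have hQ : ((Matrix.GeneralLinearGroup.mkOfDetNeZero !![(1 : L), 0, 1; 0, 1, 0; 1, 0, -1] (det_quasiSplitFrame_ne_zero L) : GL (Fin 3) L) :
      Matrix (Fin 3) (Fin 3) L).map (cmConjRingHom L) = !![(1 : L), 0, 1; 0, 1, 0; 1, 0, -1] := by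
    rw [Matrix.GeneralLinearGroup.val_mkOfDetNeZero]
    ext i j
    fin_cases i <;> fin_cases j <;> simp
  rw [formCongr, hQ, Matrix.GeneralLinearGroup.val_mkOfDetNeZero]
  ext i j
  fin_cases i <;> fin_cases j <;> simp [Matrix.mul_apply, Fin.sum_univ_three, Matrix.diagonal] <;> ring

omit [NumberField L] [IsCMField L] in
/-- The quasi-split weights `β = (½, 1, −½)` are non-zero (characteristic zero) — the frame guard `hα` of the torus stack. [cite: Rogawski1990, §14.1 p. 232] -/
theorem quasiSplitWeights_ne_zero [CharZero L] : ∀ i : Fin 3, (![(2 : L)⁻¹, 1, -(2 : L)⁻¹]) i ≠ 0 := by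
  intro i
  fin_cases i <;> simp

/-- `c β_i = β_i`: the diagonal form `diag(½, 1, −½)` is `c`-hermitian (the frame guard `hherm`). [cite: Rogawski1990, §14.1 p. 232] -/
theorem cmConjRingHom_quasiSplitWeights : ∀ i : Fin 3, cmConjRingHom L ((![(2 : L)⁻¹, 1, -(2 : L)⁻¹]) i) = (![(2 : L)⁻¹, 1, -(2 : L)⁻¹]) i := by
  intro i
  fin_cases i <;> simp [map_ofNat]

/-- `(c · diag β)ᵀ = diag β` for `β = (½, 1, −½)` (the `hherm` guard in matrix form). [cite: Rogawski1990, §14.1 p. 232] -/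
theorem transpose_map_cmConjRingHom_diagonal_quasiSplitWeights :
    ((Matrix.diagonal ![(2 : L)⁻¹, 1, -(2 : L)⁻¹]).map (cmConjRingHom L))ᵀ = Matrix.diagonal ![(2 : L)⁻¹, 1, -(2 : L)⁻¹] := by
  rw [Matrix.diagonal_map (map_zero _), Matrix.diagonal_transpose]
  congr 1
  funext i
  exact cmConjRingHom_quasiSplitWeights L i

omit [IsCMField L] in
/-- `σ_w β_i` is REAL at every complex embedding (the frame guard `hreal`): `im σ_w(½) = im σ_w(1) = im σ_w(−½) = 0`. [cite: Rogawski1990, §14.1 p. 232] -/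
theorem im_embedding_quasiSplitWeights_eq_zero (w : {w : InfinitePlace L // IsComplex w}) :
    ∀ i : Fin 3, (w.1.embedding ((![(2 : L)⁻¹, 1, -(2 : L)⁻¹]) i)).im = 0 := by
  intro i
  fin_cases i <;> simp [map_inv₀, map_ofNat]

omit [IsCMField L] in
/-- The real parts: `re σ_w β = (½, 1, −½)`. [cite: Rogawski1990, §14.1 p. 232] -/
theorem re_embedding_quasiSplitWeights (w : {w : InfinitePlace L // IsComplex w}) (i : Fin 3) :
    (w.1.embedding ((![(2 : L)⁻¹, 1, -(2 : L)⁻¹]) i)).re = (![(2 : ℝ)⁻¹, 1, -(2 : ℝ)⁻¹]) i := by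
  have h2 : w.1.embedding (2 : L) = ((2 : ℝ) : ℂ) := by
    rw [map_ofNat, Complex.ofReal_ofNat]
  have hinv : w.1.embedding ((2 : L)⁻¹) = (((2 : ℝ)⁻¹ : ℝ) : ℂ) := by
    rw [map_inv₀, h2, Complex.ofReal_inv]
  fin_cases i
  · show (w.1.embedding ((2 : L)⁻¹)).re = (2 : ℝ)⁻¹
    rw [hinv, Complex.ofReal_re]
  · show (w.1.embedding (1 : L)).re = 1
    rw [map_one, Complex.one_re]
  · show (w.1.embedding (-(2 : L)⁻¹)).re = -(2 : ℝ)⁻¹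
    rw [map_neg, hinv, ← Complex.ofReal_neg, Complex.ofReal_re]

omit [IsCMField L] in
/-- **EVERY complex place is a `(2,1)` place for `β`, with the `{0,2}`-wall NONCOMPACT**: `re σ_w β₀ · re σ_w β₂ = −¼ < 0` (the guard `hnc` of ★ `ArchLimitFormulaNoncompactWall`).
[cite: Rogawski1990, §8.2 p. 122; §14.1 p. 232] -/
theorem re_embedding_quasiSplitWeights_zero_mul_two_neg (w : {w : InfinitePlace L // IsComplex w}) :
    (w.1.embedding ((![(2 : L)⁻¹, 1, -(2 : L)⁻¹]) 0)).re * (w.1.embedding ((![(2 : L)⁻¹, 1, -(2 : L)⁻¹]) 2)).re < 0 := by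
  rw [re_embedding_quasiSplitWeights, re_embedding_quasiSplitWeights]
  simp only [Matrix.cons_val_zero, Matrix.cons_val_two, Matrix.tail_cons, Matrix.head_cons]
  norm_num

omit [IsCMField L] in
/-- … and the `{0,1}`-wall COMPACT (`re σ_w β₀ · re σ_w β₁ = ½ > 0`, the guard of ★ (J-cw) `tendsto_deriv_sin_smul_integral_compactWall`), the `{1,2}`-wall noncompact.
[cite: Rogawski1990, §8.2 p. 122; §14.1 p. 232] -/
theorem re_embedding_quasiSplitWeights_zero_mul_one_pos (w : {w : InfinitePlace L // IsComplex w}) :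
    0 < (w.1.embedding ((![(2 : L)⁻¹, 1, -(2 : L)⁻¹]) 0)).re * (w.1.embedding ((![(2 : L)⁻¹, 1, -(2 : L)⁻¹]) 1)).re ∧
      (w.1.embedding ((![(2 : L)⁻¹, 1, -(2 : L)⁻¹]) 1)).re * (w.1.embedding ((![(2 : L)⁻¹, 1, -(2 : L)⁻¹]) 2)).re < 0 := by
  rw [re_embedding_quasiSplitWeights, re_embedding_quasiSplitWeights, re_embedding_quasiSplitWeights]
  simp only [Matrix.cons_val_zero, Matrix.cons_val_one, Matrix.cons_val_two, Matrix.tail_cons, Matrix.head_cons]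
  norm_num

end QuasiSplit

end UnitaryGroup

end Literature.NumberTheory.Automorphic

end
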